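import Literature.Analysis.FluidPDE.HelicityDensityTransport
import Literature.Analysis.FluidPDE.VorticityEquation
import Literature.Analysis.FluidPDE.WholeSpaceIBP
import Literature.Analysis.FluidPDE.SpaceTimeCalculus
import Literature.Analysis.FluidPDE.SpaceTimeCalculusC1
import HarnessLib

/-!
# The windowed helicity budget on `ℝ³`: `d/dt ∫ φ u·ω = ∫ (u·ω) u·∇φ + ∫ (p − ½|u|²) ω·∇φ + ν ∫ φ(Δu·ω + u·Δω)`
# for classical Navier–Stokes solutions and test functions `φ ∈ C_c^∞(ℝ³)`

Analysis/FluidPDE proof file (theorems only; no definitions, no named facts): the cut-off form of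
the helicity law on the whole space — the `ℝ³` counterpart of the torus theorem
`Torus.IsClassicalNSSolutionOn.hasDerivWithinAt_integral_mul_helicityDensity`
(`TorusHelicityDensityTransport.lean`), obtained from the POINTWISE law of
`HelicityDensityTransport.lean` by differentiating under the integral sign on the support of `φ`
(`hasDerivAt_integral_of_support_subset`) and one integration by parts without boundary
(`WholeSpaceIBP.integral_mul_divergence_add_eq_zero_left`). No decay of `u` or `p` at infinity is
assumed — the weight is compactly supported (this is the form a windowed helicity budget of a
Type-I profile needs: nsreg-p1 S20 blueprint B3, nsreg-lit §R72 (C)).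

## What is printed

Majda–Bertozzi 2002, §1.6, proof of Prop. 1.12 (iv), p. 24: `(v·ω)_t + div[v(v·ω) + ω(p − ½v²)] = 0`
integrated over space gives conservation of helicity for Euler; with viscosity the sources
`ν(Δu·ω + u·Δω)` remain (Moffatt–Tsinober 1992, §2). Testing the pointwise law against `φ` and
integrating the divergence by parts gives the display above (the flux term
`∫ ⟪F, ∇φ⟫`, `F = (u·ω)u + (p − ½|u|²)ω`).

## What is here

* `IsClassicalNSSolutionOn.hasDerivAt_integral_mul_helicityDensity` — for a classical (unforced)
  solution `(u, p)` on an OPEN time set `S`, `t ∈ S`, and `φ ∈ C_c^∞(ℝ³)`: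
  `d/dt ∫ φ ⟪u, ω⟫ = ∫ ⟪u, ω⟫ ∇φ·u + ∫ (p − ½|u|²) ∇φ·ω + ν ∫ φ (⟪Δu, ω⟫ + ⟪u, Δω⟫)`.
* `IsClassicalNSSolutionOn.hasDerivAt_integral_mul_helicityDensity_of_contDiff_one` — the same
  identity for weights `φ ∈ C¹_c(ℝ³)` (only one derivative of `φ` enters; differentiation under the
  integral sign by the `C¹` space–time calculus `hasDerivAt_integral_of_contDiffOn`). This is the
  form consumed by windowed budgets with weights `η(·/R)²`, `η` a `C²` bump.

WHAT THIS IS NOT: no estimate — an exact identity for smooth solutions; the Type-I bookkeeping of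
the flux terms (B3 of the S20 blueprint) is the consumer's.

## References

* A. J. Majda, A. L. Bertozzi, *Vorticity and Incompressible Flow*, CUP 2002, §1.6 Prop. 1.12 (iv),
  proof p. 24. [`MajdaBertozziCUP2002`]
* H. K. Moffatt, A. Tsinober, Annu. Rev. Fluid Mech. 24 (1992) 281–312, §2. [`MoffattTsinober1992`]
-/

noncomputable section

open MeasureTheory Set Function Filter InnerProductSpace
open scoped RealInnerProductSpace Topology Laplacian ContDiff

namespace Literature.Analysis.FluidPDE

namespace HelicityDensityTransport

variable {S : Set ℝ} {ν : ℝ} {u : ℝ → EuclideanSpace ℝ (Fin 3) → EuclideanSpace ℝ (Fin 3)}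
  {p : ℝ → EuclideanSpace ℝ (Fin 3) → ℝ}

/-- The vorticity of a jointly smooth velocity is jointly smooth (two-line re-derivation of the
tree's `IsSmoothSpaceTimeOn.isSmoothSpaceTimeOn_vorticity`, to keep the imports short). [folklore] -/
private theorem isSmoothSpaceTimeOn_curl (h : IsSmoothSpaceTimeOn S u) (hS : UniqueDiffOn ℝ S) :
    IsSmoothSpaceTimeOn S (fun s x => curl (u s) x) := by
  have e : (fun s x => curl (u s) x) = fun s x => curlCLM (fderiv ℝ (u s) x) := by funext s x; rfl
  rw [e]
  exact (h.fderiv_slice hS).clm_comp curlCLM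

/-- **The windowed helicity budget of a classical Navier–Stokes solution on `ℝ³`.** Let `(u, p)`
be a classical solution of the unforced Navier–Stokes equations on an open time set `S`
(`IsClassicalNSSolutionOn S ν 0 u p`), `t ∈ S`, and `φ ∈ C_c^∞(ℝ³)`. Then
`d/dt ∫ φ ⟪u, ω⟫ = ∫ ⟪u, ω⟫ (∇φ·u) + ∫ (p − ½|u|²)(∇φ·ω) + ν ∫ φ (⟪Δu, ω⟫ + ⟪u, Δω⟫)`
(`ω = curl u`): the pointwise law `∂ₜ(u·ω) + div[(u·ω)u + (p − ½|u|²)ω] = ν(Δu·ω + u·Δω)`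
(`hasDerivAt_helicityDensity`) tested against `φ` and integrated by parts.
[cite: MajdaBertozziCUP2002, §1.6, proof of Prop. 1.12 (iv), p. 24]
[cite: MoffattTsinober1992, §2 (viscous helicity balance)] -/
theorem _root_.Literature.Analysis.FluidPDE.IsClassicalNSSolutionOn.hasDerivAt_integral_mul_helicityDensity
    (h : IsClassicalNSSolutionOn S ν 0 u p) (hS : IsOpen S) {t : ℝ} (ht : t ∈ S)
    {φ : EuclideanSpace ℝ (Fin 3) → ℝ} (hφ : ContDiff ℝ ∞ φ) (hφc : HasCompactSupport φ) :
    HasDerivAt (fun s => ∫ x, φ x * ⟪u s x, curl (u s) x⟫)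
      ((∫ x, ⟪u t x, curl (u t) x⟫ * fderiv ℝ φ x (u t x)) +
        (∫ x, (p t x - (1 / 2) * ‖u t x‖ ^ 2) * fderiv ℝ φ x (curl (u t) x)) +
        ν * ∫ x, φ x * (⟪Δ (u t) x, curl (u t) x⟫ + ⟪u t x, Δ (curl (u t)) x⟫)) t := by
  have hSu : UniqueDiffOn ℝ S := hS.uniqueDiffOn
  -- smoothness bookkeeping
  have hu : IsSmoothSpaceTimeOn S u := h.smooth_velocity
  have hω : IsSmoothSpaceTimeOn S (fun s x => curl (u s) x) := isSmoothSpaceTimeOn_curl hu hSu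
  have hΦ : IsSmoothSpaceTimeOn S (fun s x => φ x * ⟪u s x, curl (u s) x⟫) :=
    (isSmoothSpaceTimeOn_const_time hφ S).mul (hu.inner hω)
  have hsupp : ∀ s ∈ S, ∀ x ∉ tsupport φ, φ x * ⟪u s x, curl (u s) x⟫ = 0 := fun s _ x hx => by
    rw [image_eq_zero_of_notMem_tsupport hx, zero_mul]
  have hD := hasDerivAt_integral_of_support_subset (μ := volume) hS hΦ hφc hsupp ht
  -- the slices at time `t`
  have hut : ContDiff ℝ ∞ (u t) := hu.contDiff_slice ht
  have hpt : ContDiff ℝ ∞ (p t) := h.smooth_pressure.contDiff_slice ht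
  have hωt : ContDiff ℝ ∞ (curl (u t)) := hω.contDiff_slice ht
  have hdiv : ∀ x, VectorCalculus.divergence (u t) x = 0 := h.divFree t ht
  -- the pointwise law at every `x`
  have hpt' : ∀ x, deriv (fun s => φ x * ⟪u s x, curl (u s) x⟫) t =
      φ x * (-VectorCalculus.divergence
          (fun y => ⟪u t y, curl (u t) y⟫ • u t y + (p t y - (1 / 2) * ‖u t y‖ ^ 2) • curl (u t) y) x +
        ν * (⟪Δ (u t) x, curl (u t) x⟫ + ⟪u t x, Δ (curl (u t)) x⟫)) := by
    intro x
    -- momentum and vorticity equations at `(t, x)` in `HasDerivAt` form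
    have hmomv := h.momentum t ht x
    rw [timeDerivWithin_eq_deriv hS ht] at hmomv
    have hmom : HasDerivAt (fun s => u s x)
        (ν • Δ (u t) x - convect (u t) (u t) x - gradient (p t) x) t := by
      have hd := hu.hasDerivAt_timeLine hS ht x
      have e : deriv (fun s => u s x) t = ν • Δ (u t) x - convect (u t) (u t) x - gradient (p t) x := by
        have h0 := hmomv
        simp only [Pi.zero_apply, add_zero] at h0
        rw [eq_sub_of_add_eq h0]
        abel
      rwa [e] at hd
    have hvortv := h.vorticity_eq hSu (by rw [hS.interior_eq]; exact subset_closure)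
      (fun _ _ y => curl_zero y) ht x
    rw [timeDerivWithin_eq_deriv hS ht, vorticity_apply] at hvortv
    have hvort : HasDerivAt (fun s => curl (u s) x)
        (ν • Δ (curl (u t)) x - convect (u t) (curl (u t)) x + convect (curl (u t)) (u t) x) t := by
      have hd := hω.hasDerivAt_timeLine hS ht x
      have e0 : (fun s => vorticity u s x) = fun s => curl (u s) x := by
        funext s; rw [vorticity_apply]
      rw [e0] at hvortv
      have e : deriv (fun s => curl (u s) x) t =
          ν • Δ (curl (u t)) x - convect (u t) (curl (u t)) x + convect (curl (u t)) (u t) x := by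
        rw [eq_sub_of_add_eq hvortv]
        abel
      rwa [e] at hd
    have hlaw := hasDerivAt_helicityDensity (contDiff_infty.1 hut 2).contDiffAt (hpt.differentiable (by simp) x)
      (hdiv x) hmom hvort
    exact (hlaw.const_mul (φ x)).deriv
  -- names for the flux and the viscous source
  set F : EuclideanSpace ℝ (Fin 3) → EuclideanSpace ℝ (Fin 3) := fun y =>
    ⟪u t y, curl (u t) y⟫ • u t y + (p t y - (1 / 2) * ‖u t y‖ ^ 2) • curl (u t) y with hF
  set V : EuclideanSpace ℝ (Fin 3) → ℝ := fun x =>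
    ⟪Δ (u t) x, curl (u t) x⟫ + ⟪u t x, Δ (curl (u t)) x⟫ with hV
  have hF1 : ContDiff ℝ 1 F :=
    contDiff_infty.1 (((hut.inner ℝ hωt).smul hut).add
      ((hpt.sub (contDiff_const.mul (hut.norm_sq ℝ))).smul hωt)) 1
  have hφ1 : ContDiff ℝ 1 φ := contDiff_infty.1 hφ 1
  -- continuity of the densities
  have hdivc : Continuous (VectorCalculus.divergence F) :=
    continuous_divergence (hF1.continuous_fderiv one_ne_zero)
  have hΔu : Continuous (Δ (u t)) := continuous_laplacian (contDiff_infty.1 hut 2)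
  have hΔω : Continuous (Δ (curl (u t))) := continuous_laplacian (contDiff_infty.1 hωt 2)
  have hVc : Continuous V :=
    (hΔu.inner hωt.continuous).add (hut.continuous.inner hΔω)
  -- integrability (everything carries the compactly supported factor `φ` or `∇φ`)
  have hIdiv : Integrable (fun x => φ x * VectorCalculus.divergence F x) :=
    (hφ.continuous.mul hdivc).integrable_of_hasCompactSupport hφc.mul_right
  have hIV : Integrable (fun x => φ x * V x) :=
    (hφ.continuous.mul hVc).integrable_of_hasCompactSupport hφc.mul_right
  have hdφc : HasCompactSupport (fderiv ℝ φ) := hφc.fderiv (𝕜 := ℝ)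
  have hdφ : Continuous (fderiv ℝ φ) := hφ1.continuous_fderiv one_ne_zero
  have hc₁ : Continuous (fun x => ⟪u t x, curl (u t) x⟫ * fderiv ℝ φ x (u t x)) :=
    (hut.continuous.inner hωt.continuous).mul (hdφ.clm_apply hut.continuous)
  have hc₂ : Continuous (fun x => (p t x - (1 / 2) * ‖u t x‖ ^ 2) * fderiv ℝ φ x (curl (u t) x)) :=
    (hpt.continuous.sub (continuous_const.mul (hut.continuous.norm.pow 2))).mul
      (hdφ.clm_apply hωt.continuous)
  have hI₁ : Integrable (fun x => ⟪u t x, curl (u t) x⟫ * fderiv ℝ φ x (u t x)) := by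
    refine hc₁.integrable_of_hasCompactSupport (hdφc.mono fun x hx => ?_)
    simp only [mem_support, ne_eq] at hx ⊢
    intro h0
    exact hx (by rw [h0, _root_.zero_apply, mul_zero])
  have hI₂ : Integrable (fun x => (p t x - (1 / 2) * ‖u t x‖ ^ 2) * fderiv ℝ φ x (curl (u t) x)) := by
    refine hc₂.integrable_of_hasCompactSupport (hdφc.mono fun x hx => ?_)
    simp only [mem_support, ne_eq] at hx ⊢
    intro h0
    exact hx (by rw [h0, _root_.zero_apply, mul_zero])
  -- integration by parts of the flux against `φ`
  have hibp := integral_mul_divergence_add_eq_zero_left (u := F) hφ1 hF1 hφc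
  have hgrad : ∀ v : EuclideanSpace ℝ (Fin 3), ∀ x, ⟪v, gradient φ x⟫ = fderiv ℝ φ x v := fun v x => by
    rw [real_inner_comm, gradient, InnerProductSpace.toDual_symm_apply]
  have hflux : ∫ x, ⟪F x, gradient φ x⟫ =
      (∫ x, ⟪u t x, curl (u t) x⟫ * fderiv ℝ φ x (u t x)) +
        ∫ x, (p t x - (1 / 2) * ‖u t x‖ ^ 2) * fderiv ℝ φ x (curl (u t) x) := by
    rw [← integral_add hI₁ hI₂]
    refine integral_congr_ae (Eventually.of_forall fun x => ?_)
    beta_reduce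
    rw [hgrad]
    simp only [hF, map_add, map_smul, smul_eq_mul]
  -- assemble
  refine hD.congr_deriv ?_
  calc ∫ x, deriv (fun s => φ x * ⟪u s x, curl (u s) x⟫) t
      = ∫ x, (ν * (φ x * V x) - φ x * VectorCalculus.divergence F x) := by
        refine integral_congr_ae (Eventually.of_forall fun x => ?_)
        simp only [hpt' x, hF, hV]
        ring
    _ = ν * (∫ x, φ x * V x) - ∫ x, φ x * VectorCalculus.divergence F x := by
        rw [integral_sub (hIV.const_mul ν) hIdiv, integral_const_mul]
    _ = _ := by
        rw [show (∫ x, φ x * VectorCalculus.divergence F x) = -∫ x, ⟪F x, gradient φ x⟫ by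
          linarith, hflux]
        ring

/-- **The windowed helicity budget with a `C¹_c` weight.** Let `(u, p)` be a classical solution of
the unforced Navier–Stokes equations on an open time set `S` (`IsClassicalNSSolutionOn S ν 0 u p`),
`t ∈ S`, and `φ ∈ C¹_c(ℝ³)`. Then
`d/dt ∫ φ ⟪u, ω⟫ = ∫ ⟪u, ω⟫ (∇φ·u) + ∫ (p − ½|u|²)(∇φ·ω) + ν ∫ φ (⟪Δu, ω⟫ + ⟪u, Δω⟫)`
(`ω = curl u`). Same proof as `hasDerivAt_integral_mul_helicityDensity`; only one derivative of the
weight is used (the integrand `φ(x)⟪u, ω⟫(s, x)` is jointly `C¹`, so the `C¹` differentiation lemma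
`hasDerivAt_integral_of_contDiffOn` replaces the smooth one). This is the form needed by windowed
budgets with weights `η(·/R)²` for a `C²` bump `η`.
[cite: MajdaBertozziCUP2002, §1.6, proof of Prop. 1.12 (iv), p. 24]
[cite: MoffattTsinober1992, §2 (viscous helicity balance)] -/
theorem _root_.Literature.Analysis.FluidPDE.IsClassicalNSSolutionOn.hasDerivAt_integral_mul_helicityDensity_of_contDiff_one
    (h : IsClassicalNSSolutionOn S ν 0 u p) (hS : IsOpen S) {t : ℝ} (ht : t ∈ S)
    {φ : EuclideanSpace ℝ (Fin 3) → ℝ} (hφ : ContDiff ℝ 1 φ) (hφc : HasCompactSupport φ) :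
    HasDerivAt (fun s => ∫ x, φ x * ⟪u s x, curl (u s) x⟫)
      ((∫ x, ⟪u t x, curl (u t) x⟫ * fderiv ℝ φ x (u t x)) +
        (∫ x, (p t x - (1 / 2) * ‖u t x‖ ^ 2) * fderiv ℝ φ x (curl (u t) x)) +
        ν * ∫ x, φ x * (⟪Δ (u t) x, curl (u t) x⟫ + ⟪u t x, Δ (curl (u t)) x⟫)) t := by
  have hSu : UniqueDiffOn ℝ S := hS.uniqueDiffOn
  -- smoothness bookkeeping
  have hu : IsSmoothSpaceTimeOn S u := h.smooth_velocity
  have hω : IsSmoothSpaceTimeOn S (fun s x => curl (u s) x) := isSmoothSpaceTimeOn_curl hu hSu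
  -- the integrand `(s, x) ↦ φ x ⟪u, ω⟫(s, x)` is jointly `C¹` on `S × ℝ³`
  have hΦ : ContDiffOn ℝ 1 (uncurry fun s x => φ x * ⟪u s x, curl (u s) x⟫) (S ×ˢ univ) := by
    have h1 : ContDiffOn ℝ 1 (fun q : ℝ × EuclideanSpace ℝ (Fin 3) => φ q.2) (S ×ˢ univ) :=
      (hφ.comp contDiff_snd).contDiffOn
    have h2 : ContDiffOn ℝ 1 (uncurry u) (S ×ˢ univ) := (hu : ContDiffOn ℝ ∞ (uncurry u) _).of_le (by
      exact_mod_cast le_top)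
    have h3 : ContDiffOn ℝ 1 (uncurry fun s x => curl (u s) x) (S ×ˢ univ) :=
      (hω : ContDiffOn ℝ ∞ (uncurry fun s x => curl (u s) x) _).of_le (by exact_mod_cast le_top)
    have h4 := h1.mul (h2.inner ℝ h3)
    refine h4.congr fun q _ => ?_
    rcases q with ⟨s, x⟩
    rfl
  have hsupp : ∀ s ∈ S, ∀ x ∉ tsupport φ, φ x * ⟪u s x, curl (u s) x⟫ = 0 := fun s _ x hx => by
    rw [image_eq_zero_of_notMem_tsupport hx, zero_mul]
  have hD := hasDerivAt_integral_of_contDiffOn (μ := volume) hS hΦ hφc hsupp ht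
  -- the slices at time `t`
  have hut : ContDiff ℝ ∞ (u t) := hu.contDiff_slice ht
  have hpt : ContDiff ℝ ∞ (p t) := h.smooth_pressure.contDiff_slice ht
  have hωt : ContDiff ℝ ∞ (curl (u t)) := hω.contDiff_slice ht
  have hdiv : ∀ x, VectorCalculus.divergence (u t) x = 0 := h.divFree t ht
  -- the pointwise law at every `x`
  have hpt' : ∀ x, deriv (fun s => φ x * ⟪u s x, curl (u s) x⟫) t =
      φ x * (-VectorCalculus.divergence
          (fun y => ⟪u t y, curl (u t) y⟫ • u t y + (p t y - (1 / 2) * ‖u t y‖ ^ 2) • curl (u t) y) x +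
        ν * (⟪Δ (u t) x, curl (u t) x⟫ + ⟪u t x, Δ (curl (u t)) x⟫)) := by
    intro x
    -- momentum and vorticity equations at `(t, x)` in `HasDerivAt` form
    have hmomv := h.momentum t ht x
    rw [timeDerivWithin_eq_deriv hS ht] at hmomv
    have hmom : HasDerivAt (fun s => u s x)
        (ν • Δ (u t) x - convect (u t) (u t) x - gradient (p t) x) t := by
      have hd := hu.hasDerivAt_timeLine hS ht x
      have e : deriv (fun s => u s x) t = ν • Δ (u t) x - convect (u t) (u t) x - gradient (p t) x := by
        have h0 := hmomv
        simp only [Pi.zero_apply, add_zero] at h0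
        rw [eq_sub_of_add_eq h0]
        abel
      rwa [e] at hd
    have hvortv := h.vorticity_eq hSu (by rw [hS.interior_eq]; exact subset_closure)
      (fun _ _ y => curl_zero y) ht x
    rw [timeDerivWithin_eq_deriv hS ht, vorticity_apply] at hvortv
    have hvort : HasDerivAt (fun s => curl (u s) x)
        (ν • Δ (curl (u t)) x - convect (u t) (curl (u t)) x + convect (curl (u t)) (u t) x) t := by
      have hd := hω.hasDerivAt_timeLine hS ht x
      have e0 : (fun s => vorticity u s x) = fun s => curl (u s) x := by
        funext s; rw [vorticity_apply]
      rw [e0] at hvortv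
      have e : deriv (fun s => curl (u s) x) t =
          ν • Δ (curl (u t)) x - convect (u t) (curl (u t)) x + convect (curl (u t)) (u t) x := by
        rw [eq_sub_of_add_eq hvortv]
        abel
      rwa [e] at hd
    have hlaw := hasDerivAt_helicityDensity (contDiff_infty.1 hut 2).contDiffAt (hpt.differentiable (by simp) x)
      (hdiv x) hmom hvort
    exact (hlaw.const_mul (φ x)).deriv
  -- names for the flux and the viscous source
  set F : EuclideanSpace ℝ (Fin 3) → EuclideanSpace ℝ (Fin 3) := fun y =>
    ⟪u t y, curl (u t) y⟫ • u t y + (p t y - (1 / 2) * ‖u t y‖ ^ 2) • curl (u t) y with hF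
  set V : EuclideanSpace ℝ (Fin 3) → ℝ := fun x =>
    ⟪Δ (u t) x, curl (u t) x⟫ + ⟪u t x, Δ (curl (u t)) x⟫ with hV
  have hF1 : ContDiff ℝ 1 F :=
    contDiff_infty.1 (((hut.inner ℝ hωt).smul hut).add
      ((hpt.sub (contDiff_const.mul (hut.norm_sq ℝ))).smul hωt)) 1
  have hφ1 : ContDiff ℝ 1 φ := hφ
  -- continuity of the densities
  have hdivc : Continuous (VectorCalculus.divergence F) :=
    continuous_divergence (hF1.continuous_fderiv one_ne_zero)
  have hΔu : Continuous (Δ (u t)) := continuous_laplacian (contDiff_infty.1 hut 2)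
  have hΔω : Continuous (Δ (curl (u t))) := continuous_laplacian (contDiff_infty.1 hωt 2)
  have hVc : Continuous V :=
    (hΔu.inner hωt.continuous).add (hut.continuous.inner hΔω)
  -- integrability (everything carries the compactly supported factor `φ` or `∇φ`)
  have hIdiv : Integrable (fun x => φ x * VectorCalculus.divergence F x) :=
    (hφ.continuous.mul hdivc).integrable_of_hasCompactSupport hφc.mul_right
  have hIV : Integrable (fun x => φ x * V x) :=
    (hφ.continuous.mul hVc).integrable_of_hasCompactSupport hφc.mul_right
  have hdφc : HasCompactSupport (fderiv ℝ φ) := hφc.fderiv (𝕜 := ℝ)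
  have hdφ : Continuous (fderiv ℝ φ) := hφ1.continuous_fderiv one_ne_zero
  have hc₁ : Continuous (fun x => ⟪u t x, curl (u t) x⟫ * fderiv ℝ φ x (u t x)) :=
    (hut.continuous.inner hωt.continuous).mul (hdφ.clm_apply hut.continuous)
  have hc₂ : Continuous (fun x => (p t x - (1 / 2) * ‖u t x‖ ^ 2) * fderiv ℝ φ x (curl (u t) x)) :=
    (hpt.continuous.sub (continuous_const.mul (hut.continuous.norm.pow 2))).mul
      (hdφ.clm_apply hωt.continuous)
  have hI₁ : Integrable (fun x => ⟪u t x, curl (u t) x⟫ * fderiv ℝ φ x (u t x)) := by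
    refine hc₁.integrable_of_hasCompactSupport (hdφc.mono fun x hx => ?_)
    simp only [mem_support, ne_eq] at hx ⊢
    intro h0
    exact hx (by rw [h0, _root_.zero_apply, mul_zero])
  have hI₂ : Integrable (fun x => (p t x - (1 / 2) * ‖u t x‖ ^ 2) * fderiv ℝ φ x (curl (u t) x)) := by
    refine hc₂.integrable_of_hasCompactSupport (hdφc.mono fun x hx => ?_)
    simp only [mem_support, ne_eq] at hx ⊢
    intro h0
    exact hx (by rw [h0, _root_.zero_apply, mul_zero])
  -- integration by parts of the flux against `φ`
  have hibp := integral_mul_divergence_add_eq_zero_left (u := F) hφ1 hF1 hφc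
  have hgrad : ∀ v : EuclideanSpace ℝ (Fin 3), ∀ x, ⟪v, gradient φ x⟫ = fderiv ℝ φ x v := fun v x => by
    rw [real_inner_comm, gradient, InnerProductSpace.toDual_symm_apply]
  have hflux : ∫ x, ⟪F x, gradient φ x⟫ =
      (∫ x, ⟪u t x, curl (u t) x⟫ * fderiv ℝ φ x (u t x)) +
        ∫ x, (p t x - (1 / 2) * ‖u t x‖ ^ 2) * fderiv ℝ φ x (curl (u t) x) := by
    rw [← integral_add hI₁ hI₂]
    refine integral_congr_ae (Eventually.of_forall fun x => ?_)
    beta_reduce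
    rw [hgrad]
    simp only [hF, map_add, map_smul, smul_eq_mul]
  -- assemble
  refine hD.congr_deriv ?_
  calc ∫ x, deriv (fun s => φ x * ⟪u s x, curl (u s) x⟫) t
      = ∫ x, (ν * (φ x * V x) - φ x * VectorCalculus.divergence F x) := by
        refine integral_congr_ae (Eventually.of_forall fun x => ?_)
        simp only [hpt' x, hF, hV]
        ring
    _ = ν * (∫ x, φ x * V x) - ∫ x, φ x * VectorCalculus.divergence F x := by
        rw [integral_sub (hIV.const_mul ν) hIdiv, integral_const_mul]
    _ = _ := by
        rw [show (∫ x, φ x * VectorCalculus.divergence F x) = -∫ x, ⟪F x, gradient φ x⟫ by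
          linarith, hflux]
        ring

end HelicityDensityTransport

end Literature.Analysis.FluidPDE
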